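import Literature.AnabelianGeometry.SemiGraphs.ArithmeticCurves
import HarnessLib

/-!
# [SemiAnbd] Example 5.6: the recipe's well-definedness clause from Rmk 5.3.1 and Thm 5.4 (i)
# (FACT-LIST row F-1450 `Ex56ObjectRecipeStatement`, clause "these characterizations make sense")

Mochizuki, *Semi-graphs of anabelioids*, Publ. RIMS **42** (2006) [SemiAnbd], Example 5.6 pp. 67–68
of the author's manuscript (kurims `paper:url-f33ace170ff4`): "if `v` (resp. `e`) is a vertex (resp.
edge) of `𝒢_i` such that the image in `Π^temp_{𝔊_j}` of the verticial (resp. edge-like) subgroup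
determined by `v` (resp. `e`) is contained in a [necessarily unique] edge-like subgroup `H` … then …;
if … is not contained in an edge-like subgroup … but is contained in a verticial subgroup `H` … then … .
That these characterizations make sense … follows from Theorem 5.4, (i), (ii); Lemma 5.5."
[cite: MochizukiSemiAnbd2006, Ex 5.6, pp. 67–68]

PROOF-ONLY companion of `ArithmeticCurves.lean` (abc-iut-L3-t3, p405547 / p407122; imported, never
edited) — abc-iut cell, block F fact-proving wave, seat abc-iut-f-158 (tranche 158 = F-1449 / F-1450 /
F-1451).  No definition, no instance, no new named fact.

WHAT IS PROVED.  The typed CLAIM `Ex56ObjectRecipeStatement Ω` (F-1450) has, for every vertex `v`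
(resp. branch `x`) of `𝒢_i` and `j ≤ i`, three conjuncts: (1) the image of `Π_{𝔊_i,v}` (resp.
`Π_{𝔊_i,x}`) under `Π^temp_{𝔊_i} → Π^temp_{𝔊_j}` lies in SOME verticial or edge-like subgroup of
`Π^temp_{𝔊_j}` ("these characterizations make sense"), (2)/(3) the specialisation map on components
agrees with the subgroup recipe ("yield the map on objects").  Conjunct (1) is the part print
attributes to Theorem 5.4 (i); it is proved here FOR EVERY TOWER `T : StableReductionTower 𝓥 D` (no
origin certificate needed) from the two named facts it cites, taken AT THE LEVELS of the tower:

* Rmk 5.3.1 at level `i` — `VerticialEdgeLikeCompactAmpleStatement (T.dec i) (T.augmentation i)`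
  (FACT-LIST F-1410; discharged over chart data by abc-iut-w4-d029, `ArithVerticialCompactAmple.lean`):
  verticial and edge-like subgroups of `Π^temp_{𝔊_i}` are compact and arithmetically ample;
* Thm 5.4 (i) at level `j` — `ArithMaximalCompactStatementI (T.dec j) (T.augmentation j)` (FACT-LIST
  F-1398; assembled over `ArithLevelData` by abc-iut-w4-d053/d059, `ArithLevelDataThm54.lean`): every
  arithmetically ample compact subgroup of `Π^temp_{𝔊_j}` lies in a verticial subgroup.

The group theory in between is kernel-checked: the transition map `Π^temp_{𝔊_i} → Π^temp_{𝔊_j}` is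
continuous (`continuous_transition`) and commutes with the augmentations to `G_K`
(`augmentation_comp_transition`), so it carries compact subgroups to compact subgroups
(`isCompact_map_transition`) and arithmetically ample ones to arithmetically ample ones
(`isArithAmple_map_transition` — the images in `G_K` coincide); Thm 5.4 (i) then applies
(`exists_isVerticial_ge_map_transition`), giving conjunct (1) for vertices
(`ex56Recipe_wellDefined_vert`) and for branches (`ex56Recipe_wellDefined_br`), packaged over the
origin certificate as `ex56ObjectRecipe_wellDefined_of_levels`.

WHAT IS NOT PROVED (recorded).  Conjuncts (2)/(3) — that the functor `Cat(𝒢_i) → Cat(𝒢_j)` induced by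
"the map on geometric special fibers between the coverings" (Example 3.10 p. 44) IS the map the recipe
names — are the geometric content of the Example; on abstract towers the fields `spV`, `spE` are free
data, so they hold only for CERTIFIED towers (`Ω.IsStableReductionTowerOf D T`, an uninterpreted
certificate; FOUNDATIONS rows 13–14: André's `π₁^temp`, stable reduction) and F-1450 remains a named
fact BY NAME for them.  HONEST FRAMING: nothing of [SemiAnbd] is asserted; a reduction of one clause of a
typed fact to two other typed facts is bookkeeping of the printed proof, not a discharge of the row; no
side is taken on [IUTchIII] Cor. 3.12; typed ≠ proved.
-/

namespace Literature.AnabelianGeometry.SemiGraphs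

open _root_.CategoryTheory Literature.AlgebraicGeometry.Frobenioids Topology

universe u v w u'

variable {Obj : Type u} [Category.{v} Obj] {𝓥 : SemiAnbdVocab.{u, v, w} Obj}
variable {K : Type u'} [Field K]

namespace StableReductionTower

variable {D : TemperedArithmeticGroup K} (T : StableReductionTower 𝓥 D)

/-! ### The transition maps `Π^temp_{𝔊_i} → Π^temp_{𝔊_j}`: continuity and compatibility with `G_K` -/

/-- The transition map `Π^temp_{𝔊_i} → Π^temp_{𝔊_j}` (`j ≤ i`) is induced on quotients by the inclusion
`M_i ⊆ M_j`: `transition (mk m) = mk (inclusion m)`. [cite: MochizukiSemiAnbd2006, Ex 5.6, p. 67] -/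
theorem transition_mk (i j : ℕ) (h : j ≤ i) (m : T.M i) :
    T.transition i j h (QuotientGroup.mk m) =
      QuotientGroup.mk (Subgroup.inclusion (T.antitone_M h) m) :=
  rfl

/-- The inclusion `M_i ↪ M_j` of subgroups of the topological group `Π` is continuous (subspace
topologies). [folklore] -/
private theorem continuous_inclusion_M (i j : ℕ) (h : j ≤ i) :
    Continuous (Subgroup.inclusion (T.antitone_M h) : T.M i → T.M j) :=
  continuous_induced_rng.2 continuous_subtype_val

/-- **The transition map `Π^temp_{𝔊_i} → Π^temp_{𝔊_j}` is continuous** for the quotient topologies on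
`Π^temp_{𝔊_i} = M_i / admKer_i` (it is induced by the continuous inclusion `M_i ⊆ M_j`).
[cite: MochizukiSemiAnbd2006, Ex 5.6, p. 67] -/
theorem continuous_transition (i j : ℕ) (h : j ≤ i) : Continuous (T.transition i j h) := by
  refine (QuotientGroup.isQuotientMap_mk _).continuous_iff.mpr ?_
  have hcomp : (T.transition i j h : T.Gtp i → T.Gtp j) ∘ (QuotientGroup.mk : T.M i → T.Gtp i) =
      (QuotientGroup.mk : T.M j → T.Gtp j) ∘ Subgroup.inclusion (T.antitone_M h) := by
    funext m
    rfl
  rw [hcomp]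
  exact QuotientGroup.continuous_mk.comp (T.continuous_inclusion_M i j h)

/-- The augmentation at level `i` on a class: `augmentation i (mk m) = (image of m in G_K)`.
[cite: MochizukiSemiAnbd2006, Ex 5.6, p. 67] -/
theorem augmentation_mk (i : ℕ) (m : T.M i) :
    T.augmentation i (QuotientGroup.mk m) = D.aug (m : D.Pi) :=
  rfl

/-- **The transition maps commute with the augmentations to `G_K`**: the composite
`Π^temp_{𝔊_i} → Π^temp_{𝔊_j} → G_K` is the augmentation of level `i` (both are induced by `Π ↠ G_K`).
[cite: MochizukiSemiAnbd2006, Ex 5.6, p. 67] -/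
theorem augmentation_comp_transition (i j : ℕ) (h : j ≤ i) :
    (T.augmentation j).comp (T.transition i j h) = T.augmentation i := by
  ext x
  rfl

/-- Pointwise form of `augmentation_comp_transition`. [cite: MochizukiSemiAnbd2006, Ex 5.6, p. 67] -/
theorem augmentation_transition_apply (i j : ℕ) (h : j ≤ i) (x : T.Gtp i) :
    T.augmentation j (T.transition i j h x) = T.augmentation i x := by
  rw [← MonoidHom.comp_apply, T.augmentation_comp_transition i j h]

/-- The image in `G_K` of the image in `Π^temp_{𝔊_j}` of a subgroup `H ⊆ Π^temp_{𝔊_i}` is the image of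
`H` in `G_K`. [cite: MochizukiSemiAnbd2006, Ex 5.6, p. 67] -/
theorem map_augmentation_map_transition (i j : ℕ) (h : j ≤ i) (H : Subgroup (T.Gtp i)) :
    (H.map (T.transition i j h)).map (T.augmentation j) = H.map (T.augmentation i) := by
  rw [Subgroup.map_map, T.augmentation_comp_transition i j h]

/-! ### Transport of compactness and arithmetic ampleness along the transition maps -/

/-- **Images of compact subgroups are compact**: if `H ⊆ Π^temp_{𝔊_i}` is compact, so is its image in
`Π^temp_{𝔊_j}` (continuity of the transition map). [cite: MochizukiSemiAnbd2006, Ex 5.6, p. 67] -/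
theorem isCompact_map_transition (i j : ℕ) (h : j ≤ i) {H : Subgroup (T.Gtp i)}
    (hH : IsCompact (H : Set (T.Gtp i))) :
    IsCompact ((H.map (T.transition i j h) : Subgroup (T.Gtp j)) : Set (T.Gtp j)) := by
  rw [Subgroup.coe_map]
  exact hH.image (T.continuous_transition i j h)

/-- **Images of arithmetically ample subgroups are arithmetically ample** (Def 5.3 (i)): the image
in `G_K` does not change along `Π^temp_{𝔊_i} → Π^temp_{𝔊_j}`, so it stays open.
[cite: MochizukiSemiAnbd2006, Def 5.3 (i), p. 65] -/
theorem isArithAmple_map_transition (i j : ℕ) (h : j ≤ i) {H : Subgroup (T.Gtp i)}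
    (hH : IsArithAmple (T.augmentation i) H) :
    IsArithAmple (T.augmentation j) (H.map (T.transition i j h)) := by
  unfold IsArithAmple at hH ⊢
  rw [T.map_augmentation_map_transition i j h H]
  exact hH

/-! ### Conjunct (1) of the Example 5.6 recipe from Rmk 5.3.1 (level `i`) and Thm 5.4 (i) (level `j`) -/

/-- **Thm 5.4 (i) applied along the tower**: if Thm 5.4 (i) holds for the level-`j` data, then the
image in `Π^temp_{𝔊_j}` of any compact, arithmetically ample subgroup of `Π^temp_{𝔊_i}` lies in a
verticial subgroup of `Π^temp_{𝔊_j}`. [cite: MochizukiSemiAnbd2006, Thm 5.4 (i), p. 66] -/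
theorem exists_isVerticial_ge_map_transition (i j : ℕ) (h : j ≤ i)
    (h54 : ArithMaximalCompactStatementI (T.dec j) (T.augmentation j)) {H : Subgroup (T.Gtp i)}
    (hc : IsCompact (H : Set (T.Gtp i))) (ha : IsArithAmple (T.augmentation i) H) :
    ∃ W : Subgroup (T.Gtp j), IsVerticial (T.dec j) W ∧ H.map (T.transition i j h) ≤ W :=
  (h54 _ (T.isCompact_map_transition i j h hc) (T.isArithAmple_map_transition i j h ha)).1

/-- Conjugating a subgroup by `1` does nothing. [folklore] -/
private theorem conjSubgroup_one_eq {G : Type*} [Group G] (S : Subgroup G) :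
    conjSubgroup (1 : G) S = S := by
  ext x
  simp [conjSubgroup]

/-- The chosen representative `Π_{𝔊_i,v}` of a vertex is a verticial subgroup (Def 5.3 (iii),
conjugator `1`). [cite: MochizukiSemiAnbd2006, Def 5.3 (iii), p. 65] -/
theorem isVerticial_dec_vertGp (i : ℕ) (v : 𝓥.Vert (T.𝔊 i).G) :
    IsVerticial (T.dec i) ((T.dec i).vertGp v) :=
  ⟨v, 1, (conjSubgroup_one_eq _).symm⟩

/-- The chosen representative `Π_{𝔊_i,b}` of a branch is an edge-like subgroup (Def 5.3 (iii),
conjugator `1`). [cite: MochizukiSemiAnbd2006, Def 5.3 (iii), p. 65] -/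
theorem isEdgeLike_dec_brGp (i : ℕ) (x : Σ e : 𝓥.Edge (T.𝔊 i).G, 𝓥.Br e) :
    IsEdgeLike (T.dec i) ((T.dec i).brGp x) :=
  ⟨x, 1, (conjSubgroup_one_eq _).symm⟩

/-- **Example 5.6, conjunct (1) for vertices** ("these characterizations make sense", vertices): if
Rmk 5.3.1 holds at level `i` and Thm 5.4 (i) at level `j ≤ i`, then for every vertex `v` of `𝒢_i` the
image of `Π_{𝔊_i,v}` in `Π^temp_{𝔊_j}` is contained in a verticial or edge-like subgroup of
`Π^temp_{𝔊_j}` (indeed in a verticial one). [cite: MochizukiSemiAnbd2006, Ex 5.6, pp. 67–68] -/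
theorem ex56Recipe_wellDefined_vert (i j : ℕ) (h : j ≤ i)
    (h531 : VerticialEdgeLikeCompactAmpleStatement (T.dec i) (T.augmentation i))
    (h54 : ArithMaximalCompactStatementI (T.dec j) (T.augmentation j))
    (v : 𝓥.Vert (T.𝔊 i).G) :
    ∃ W : Subgroup (T.Gtp j), (IsVerticial (T.dec j) W ∨ IsEdgeLike (T.dec j) W) ∧
      ((T.dec i).vertGp v).map (T.transition i j h) ≤ W := by
  obtain ⟨hc, ha⟩ := h531 _ (Or.inl (T.isVerticial_dec_vertGp i v))
  obtain ⟨W, hW, hle⟩ := T.exists_isVerticial_ge_map_transition i j h h54 hc ha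
  exact ⟨W, Or.inl hW, hle⟩

/-- **Example 5.6, conjunct (1) for edges** ("these characterizations make sense", edges; the
edge-like subgroup of an edge is that of either of its branches): if Rmk 5.3.1 holds at level `i` and
Thm 5.4 (i) at level `j ≤ i`, then for every branch `x` of `𝒢_i` the image of `Π_{𝔊_i,x}` in
`Π^temp_{𝔊_j}` is contained in a verticial or edge-like subgroup of `Π^temp_{𝔊_j}`.
[cite: MochizukiSemiAnbd2006, Ex 5.6, pp. 67–68] -/
theorem ex56Recipe_wellDefined_br (i j : ℕ) (h : j ≤ i)
    (h531 : VerticialEdgeLikeCompactAmpleStatement (T.dec i) (T.augmentation i))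
    (h54 : ArithMaximalCompactStatementI (T.dec j) (T.augmentation j))
    (x : Σ e : 𝓥.Edge (T.𝔊 i).G, 𝓥.Br e) :
    ∃ W : Subgroup (T.Gtp j), (IsVerticial (T.dec j) W ∨ IsEdgeLike (T.dec j) W) ∧
      ((T.dec i).brGp x).map (T.transition i j h) ≤ W := by
  obtain ⟨hc, ha⟩ := h531 _ (Or.inr (T.isEdgeLike_dec_brGp i x))
  obtain ⟨W, hW, hle⟩ := T.exists_isVerticial_ge_map_transition i j h h54 hc ha
  exact ⟨W, Or.inl hW, hle⟩

end StableReductionTower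

/-! ### Packaged over the origin certificate (the shape of `Ex56ObjectRecipeStatement`, conjunct (1)) -/

section Packaged

variable (Ω : StableReductionOrigin 𝓥 K)

/-- **Example 5.6, the well-definedness clause of the CLAIM, for certified towers, from the level-wise
facts Rmk 5.3.1 (F-1410) and Thm 5.4 (i) (F-1398)**: in the binder shape of
`Ex56ObjectRecipeStatement Ω` (F-1450), conjunct (1) for every vertex and every branch of `𝒢_i` and
every `j ≤ i`.  The certificate hypotheses are carried, not used: the clause holds for every tower whose
levels satisfy the two named facts.  Conjuncts (2)/(3) of F-1450 (the object map IS the recipe's) are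
not touched. [cite: MochizukiSemiAnbd2006, Ex 5.6, pp. 67–68] -/
theorem ex56ObjectRecipe_wellDefined_of_levels
    (D : TemperedArithmeticGroup K) (_hD : Ω.IsOfGeometricOrigin D)
    (T : StableReductionTower 𝓥 D) (_hT : Ω.IsStableReductionTowerOf D T)
    (h531 : ∀ i, VerticialEdgeLikeCompactAmpleStatement (T.dec i) (T.augmentation i))
    (h54 : ∀ j, ArithMaximalCompactStatementI (T.dec j) (T.augmentation j))
    (i j : ℕ) (h : j ≤ i) :
    (∀ v : 𝓥.Vert (T.𝔊 i).G, ∃ W : Subgroup (T.Gtp j),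
        (IsVerticial (T.dec j) W ∨ IsEdgeLike (T.dec j) W) ∧
          ((T.dec i).vertGp v).map (T.transition i j h) ≤ W) ∧
      ∀ x : Σ e : 𝓥.Edge (T.𝔊 i).G, 𝓥.Br e, ∃ W : Subgroup (T.Gtp j),
        (IsVerticial (T.dec j) W ∨ IsEdgeLike (T.dec j) W) ∧
          ((T.dec i).brGp x).map (T.transition i j h) ≤ W :=
  ⟨fun v => T.ex56Recipe_wellDefined_vert i j h (h531 i) (h54 j) v,
    fun x => T.ex56Recipe_wellDefined_br i j h (h531 i) (h54 j) x⟩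

end Packaged

/-! ### Uniqueness in the recipe — "[necessarily unique]" — from Thm 5.4 (i), (ii) at level `j`

Appended by abc-iut-f-158 (same seat; append-only): the second half of "these characterizations make
sense … follows from Theorem 5.4, (i), (ii)".  Print's recipe names "a [necessarily unique] edge-like
subgroup `H`" containing the image, resp. (when there is none) "a verticial subgroup `H`"; the typed facts
Thm 5.4 (i) (F-1398) and Thm 5.4 (ii) (F-1399) at level `j` give exactly: an arithmetically ample compact
subgroup lies in AT MOST ONE edge-like subgroup (`ArithMaximalCompactStatementII.edgeLike_unique`, using
(i) for "at most two verticial over-groups" and (ii) for "edge-like = intersection of two distinct maximal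
compact = verticial"), and, if it lies in NO edge-like subgroup, in EXACTLY ONE verticial subgroup
(`ArithMaximalCompactStatementI.verticial_unique_of_not_edgeLike`, from (i) alone: two distinct verticial
over-groups would meet in an edge-like over-group).  RECORDED, not typed here: that the subgroup `H` in
turn "determines" an edge / a vertex of `𝒢_j` (distinct components have non-conjugate decomposition
groups) is a property of the certified geometric data (cf. Prop 2.6, Thm 3.7 (iii)), not a clause of
F-1398 / F-1399. -/

section Uniqueness

variable {Gtp : Type*} [Group Gtp] [TopologicalSpace Gtp] {PA : Type*} [Group PA] [TopologicalSpace PA]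
variable {V B : Type*} {Dj : DecompositionData Gtp V B} {aug : Gtp →* PA}

/-- **Thm 5.4 (i) ⇒ the vertex case of the Example 5.6 recipe is unambiguous**: an arithmetically ample
compact subgroup `K` contained in NO edge-like subgroup is contained in at most one verticial subgroup —
two distinct verticial subgroups containing `K` would, by Thm 5.4 (i), meet in an edge-like subgroup
containing `K`. [cite: MochizukiSemiAnbd2006, Ex 5.6, pp. 67–68] -/
theorem ArithMaximalCompactStatementI.verticial_unique_of_not_edgeLike
    (h54i : ArithMaximalCompactStatementI Dj aug) {K : Subgroup Gtp}
    (hc : IsCompact (K : Set Gtp)) (ha : IsArithAmple aug K)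
    (hK : ¬ ∃ H : Subgroup Gtp, IsEdgeLike Dj H ∧ K ≤ H) {W₁ W₂ : Subgroup Gtp}
    (hW₁ : IsVerticial Dj W₁) (hW₂ : IsVerticial Dj W₂) (h₁ : K ≤ W₁) (h₂ : K ≤ W₂) : W₁ = W₂ := by
  by_contra hne
  exact hK ⟨W₁ ⊓ W₂, ((h54i K hc ha).2 W₁ W₂ hW₁ hW₂ hne h₁ h₂).2, le_inf h₁ h₂⟩

/-- **Thm 5.4 (i) + (ii) ⇒ the edge case of the Example 5.6 recipe is unambiguous** ("[necessarily
unique]"): an arithmetically ample compact subgroup `K` is contained in at most one edge-like subgroup.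
By (ii) an edge-like subgroup is `M₁ ∩ M₂` for two distinct arithmetically maximal compact (= verticial)
subgroups; by (i) the verticial subgroups containing `K` are then exactly `M₁`, `M₂`, so a second edge-like
over-group `M₃ ∩ M₄` has `{M₃, M₄} = {M₁, M₂}`. [cite: MochizukiSemiAnbd2006, Ex 5.6, pp. 67–68] -/
theorem ArithMaximalCompactStatementII.edgeLike_unique
    (h54ii : ArithMaximalCompactStatementII Dj aug) (h54i : ArithMaximalCompactStatementI Dj aug)
    {K : Subgroup Gtp} (hc : IsCompact (K : Set Gtp)) (ha : IsArithAmple aug K)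
    {H₁ H₂ : Subgroup Gtp} (hH₁ : IsEdgeLike Dj H₁) (hH₂ : IsEdgeLike Dj H₂)
    (h₁ : K ≤ H₁) (h₂ : K ≤ H₂) : H₁ = H₂ := by
  obtain ⟨-, M₁, M₂, hM₁, hM₂, hne, rfl⟩ := (h54ii.2 H₁).mpr hH₁
  obtain ⟨-, M₃, M₄, hM₃, hM₄, hne', rfl⟩ := (h54ii.2 H₂).mpr hH₂
  have hv : ∀ {M : Subgroup Gtp}, IsArithMaximalCompact aug M → IsVerticial Dj M :=
    fun hM => (h54ii.1 _).mp hM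
  have honly := ((h54i K hc ha).2 M₁ M₂ (hv hM₁) (hv hM₂) hne (h₁.trans inf_le_left)
    (h₁.trans inf_le_right)).1
  have h₃ := honly M₃ (hv hM₃) (h₂.trans inf_le_left)
  have h₄ := honly M₄ (hv hM₄) (h₂.trans inf_le_right)
  rcases h₃ with rfl | rfl <;> rcases h₄ with rfl | rfl
  · exact absurd rfl hne'
  · rfl
  · exact inf_comm _ _
  · exact absurd rfl hne'

end Uniqueness

namespace StableReductionTower

variable {D : TemperedArithmeticGroup K} (T : StableReductionTower 𝓥 D)

/-- **Example 5.6, "[necessarily unique]" for vertices**: with Rmk 5.3.1 at level `i` and Thm 5.4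
(i), (ii) at level `j ≤ i`, the image of `Π_{𝔊_i,v}` in `Π^temp_{𝔊_j}` lies in at most one edge-like
subgroup. [cite: MochizukiSemiAnbd2006, Ex 5.6, pp. 67–68] -/
theorem ex56Recipe_edgeLike_unique_vert (i j : ℕ) (h : j ≤ i)
    (h531 : VerticialEdgeLikeCompactAmpleStatement (T.dec i) (T.augmentation i))
    (h54i : ArithMaximalCompactStatementI (T.dec j) (T.augmentation j))
    (h54ii : ArithMaximalCompactStatementII (T.dec j) (T.augmentation j))
    (v : 𝓥.Vert (T.𝔊 i).G) {H₁ H₂ : Subgroup (T.Gtp j)}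
    (hH₁ : IsEdgeLike (T.dec j) H₁) (hH₂ : IsEdgeLike (T.dec j) H₂)
    (h₁ : ((T.dec i).vertGp v).map (T.transition i j h) ≤ H₁)
    (h₂ : ((T.dec i).vertGp v).map (T.transition i j h) ≤ H₂) : H₁ = H₂ := by
  obtain ⟨hc, ha⟩ := h531 _ (Or.inl (T.isVerticial_dec_vertGp i v))
  exact h54ii.edgeLike_unique h54i (T.isCompact_map_transition i j h hc)
    (T.isArithAmple_map_transition i j h ha) hH₁ hH₂ h₁ h₂

/-- **Example 5.6, the vertex case is unambiguous, for vertices**: with Rmk 5.3.1 at level `i` and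
Thm 5.4 (i) at level `j ≤ i`, if the image of `Π_{𝔊_i,v}` lies in no edge-like subgroup of `Π^temp_{𝔊_j}`,
it lies in at most one verticial subgroup. [cite: MochizukiSemiAnbd2006, Ex 5.6, pp. 67–68] -/
theorem ex56Recipe_verticial_unique_vert (i j : ℕ) (h : j ≤ i)
    (h531 : VerticialEdgeLikeCompactAmpleStatement (T.dec i) (T.augmentation i))
    (h54i : ArithMaximalCompactStatementI (T.dec j) (T.augmentation j))
    (v : 𝓥.Vert (T.𝔊 i).G)
    (hno : ¬ ∃ H : Subgroup (T.Gtp j),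
      IsEdgeLike (T.dec j) H ∧ ((T.dec i).vertGp v).map (T.transition i j h) ≤ H)
    {W₁ W₂ : Subgroup (T.Gtp j)} (hW₁ : IsVerticial (T.dec j) W₁) (hW₂ : IsVerticial (T.dec j) W₂)
    (h₁ : ((T.dec i).vertGp v).map (T.transition i j h) ≤ W₁)
    (h₂ : ((T.dec i).vertGp v).map (T.transition i j h) ≤ W₂) : W₁ = W₂ := by
  obtain ⟨hc, ha⟩ := h531 _ (Or.inl (T.isVerticial_dec_vertGp i v))
  exact h54i.verticial_unique_of_not_edgeLike (T.isCompact_map_transition i j h hc)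
    (T.isArithAmple_map_transition i j h ha) hno hW₁ hW₂ h₁ h₂

/-- **Example 5.6, "[necessarily unique]" for edges** (branches): the image of `Π_{𝔊_i,x}` in
`Π^temp_{𝔊_j}` lies in at most one edge-like subgroup. [cite: MochizukiSemiAnbd2006, Ex 5.6, pp. 67–68] -/
theorem ex56Recipe_edgeLike_unique_br (i j : ℕ) (h : j ≤ i)
    (h531 : VerticialEdgeLikeCompactAmpleStatement (T.dec i) (T.augmentation i))
    (h54i : ArithMaximalCompactStatementI (T.dec j) (T.augmentation j))
    (h54ii : ArithMaximalCompactStatementII (T.dec j) (T.augmentation j))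
    (x : Σ e : 𝓥.Edge (T.𝔊 i).G, 𝓥.Br e) {H₁ H₂ : Subgroup (T.Gtp j)}
    (hH₁ : IsEdgeLike (T.dec j) H₁) (hH₂ : IsEdgeLike (T.dec j) H₂)
    (h₁ : ((T.dec i).brGp x).map (T.transition i j h) ≤ H₁)
    (h₂ : ((T.dec i).brGp x).map (T.transition i j h) ≤ H₂) : H₁ = H₂ := by
  obtain ⟨hc, ha⟩ := h531 _ (Or.inr (T.isEdgeLike_dec_brGp i x))
  exact h54ii.edgeLike_unique h54i (T.isCompact_map_transition i j h hc)
    (T.isArithAmple_map_transition i j h ha) hH₁ hH₂ h₁ h₂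

/-- **Example 5.6, the vertex case is unambiguous, for edges** (branches): if the image of `Π_{𝔊_i,x}`
lies in no edge-like subgroup of `Π^temp_{𝔊_j}`, it lies in at most one verticial subgroup.
[cite: MochizukiSemiAnbd2006, Ex 5.6, pp. 67–68] -/
theorem ex56Recipe_verticial_unique_br (i j : ℕ) (h : j ≤ i)
    (h531 : VerticialEdgeLikeCompactAmpleStatement (T.dec i) (T.augmentation i))
    (h54i : ArithMaximalCompactStatementI (T.dec j) (T.augmentation j))
    (x : Σ e : 𝓥.Edge (T.𝔊 i).G, 𝓥.Br e)
    (hno : ¬ ∃ H : Subgroup (T.Gtp j),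
      IsEdgeLike (T.dec j) H ∧ ((T.dec i).brGp x).map (T.transition i j h) ≤ H)
    {W₁ W₂ : Subgroup (T.Gtp j)} (hW₁ : IsVerticial (T.dec j) W₁) (hW₂ : IsVerticial (T.dec j) W₂)
    (h₁ : ((T.dec i).brGp x).map (T.transition i j h) ≤ W₁)
    (h₂ : ((T.dec i).brGp x).map (T.transition i j h) ≤ W₂) : W₁ = W₂ := by
  obtain ⟨hc, ha⟩ := h531 _ (Or.inr (T.isEdgeLike_dec_brGp i x))
  exact h54i.verticial_unique_of_not_edgeLike (T.isCompact_map_transition i j h hc)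
    (T.isArithAmple_map_transition i j h ha) hno hW₁ hW₂ h₁ h₂

end StableReductionTower

end Literature.AnabelianGeometry.SemiGraphs
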